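import Summits.Ventures.PercRepro.GenQSevenFiveCorners

/-!
# PercRepro — corner (i) of the `(7, 5)` layer `t = 4` follows from the `(6, 4)` top-type balance at the ratio
`35/27` (night-4, gen 2)

Corner (i) (`SevenFiveCornerOne`, `GenQSevenFiveCorners.lean`) asks, on every rank-`4` set `H` of a simple matroid,
`(7/6)·D_4(H) ≤ Σ_{B ∈ R_4(H)} 3/(2 + m(B))` with `D_4(H) = #{B ∈ R_4(H) : ρ(H ∖ B) = 4}`.  The landed `(6, 4)`
top-type balance is `(6/5)·D_4(H) ≤ Σ_{B ∈ R_4(H)} 2/(1 + m(B))` (`J M H 4 ≥ 0`, every solid of every size).  Since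
`3/(2 + m) ≥ (3/4)·2/(1 + m)` termwise (equality at `m = 0`), corner (i) follows from the same balance with the
constant `14/9` in place of `6/5` — the `(6, 4)` top-type balance holding at the ratio `(14/9)/(6/5) = 35/27 ≈ 1.296`:

* `StrongSixFourTop` — `(14/9)·D_4(H) ≤ Σ_{B ∈ R_4(H)} 2·w_∞(B)` on every rank-`4` set of a simple matroid;
* `sevenFiveCornerOne_of_strong : StrongSixFourTop → SevenFiveCornerOne`;
* `J_four_eq_sum_dem`: the landed `J M H 4` is `Σ (2·w_∞(B) − (6/5)·dem_4(B))`, so `StrongSixFourTop` is the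
  statement «`J M H 4 ≥ 0` with margin»: `J M H 4 ≥ (14/9 − 6/5)·D_4(H) = (16/45)·D_4(H)`.

Numerically (night-4 g2, strong64.py) the `(6, 4)` top-type ratio is `≥ 1.38` on every rank-`4` shape tried (minimum
the star of three `5`-point lines, `1.3807`; the catalogue minima of the corner-(i) ratio itself are `2.14 / 1.52 /
1.36 / 1.29` for `n = 8 … 11`, engine 4689), above the `1.296` required — so corner (i) is within reach of the cell's
`(6, 4)` machinery re-run with the constant `14/9`.  Imports `GenQSevenFiveCorners`.
-/

namespace PercRepro.GenQ

open Finset ThmH PerFlat SixFour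

variable {α : Type*} [DecidableEq α] {M : Matroid α} [M.Finite]

/-- **The `(6, 4)` top-type balance at the ratio `35/27`**: `(14/9)·D_4(H) ≤ Σ_{B ∈ R_4(H)} 2·w_∞(B)` on every
rank-`4` set `H` of a simple matroid. -/
def StrongSixFourTop : Prop :=
  ∀ {β : Type} [DecidableEq β] (M : Matroid β) [M.Finite] (H : Finset β), Simple M → H ⊆ gr M →
    M.eRk (H : Set β) = 4 → (14 / 9 : ℚ) * ∑ B ∈ Rq M H 4, dem M H 4 B ≤ ∑ B ∈ Rq M H 4, 2 * wInf M B

/-- The landed `J M H 4` as a signed sum: `Σ_{B ∈ R_4(H)} (2·w_∞(B) − (6/5)·dem_4(B))`. -/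
theorem J_four_eq_sum_dem (H : Finset α) :
    J M H 4 = ∑ B ∈ Rq M H 4, (2 * wInf M B - (6 / 5 : ℚ) * dem M H 4 B) := by
  rw [← Jq_four, Jq_eq_sum_dem]
  apply Finset.sum_congr rfl
  intro B _
  norm_num

/-- `StrongSixFourTop` is the landed top-type balance with margin: `J M H 4 ≥ (16/45)·D_4(H)`. -/
theorem J_four_ge_of_strong {γ : Type} [DecidableEq γ] {M : Matroid γ} [M.Finite] (h : StrongSixFourTop)
    (hs : Simple M) {H : Finset γ} (hH : H ⊆ gr M) (hr : M.eRk (H : Set γ) = 4) :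
    (16 / 45 : ℚ) * ∑ B ∈ Rq M H 4, dem M H 4 B ≤ J M H 4 := by
  rw [J_four_eq_sum_dem, Finset.sum_sub_distrib]
  have e : ∑ B ∈ Rq M H 4, (6 / 5 : ℚ) * dem M H 4 B = (6 / 5 : ℚ) * ∑ B ∈ Rq M H 4, dem M H 4 B :=
    (Finset.mul_sum _ _ _).symm
  rw [e]
  have := h M H hs hH hr
  linarith

/-- **Corner (i) from the strong `(6, 4)` top-type balance**: termwise `3/(2 + m) ≥ (3/4)·2/(1 + m)` and
`(3/4)·(14/9) = 7/6`. -/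
theorem sevenFiveCornerOne_of_strong (h : StrongSixFourTop) : SevenFiveCornerOne := by
  intro β _ M _ H hs hH hr
  have hstrong := h M H hs hH hr
  have hterm : ∀ B ∈ Rq M H 4, (3 / 4 : ℚ) * (2 * wInf M B) ≤ 3 / (2 + (mTr M B : ℚ)) := by
    intro B _
    unfold wInf
    have hm : (0 : ℚ) ≤ mTr M B := by positivity
    rw [mul_one_div, show (3 / 4 : ℚ) * (2 / (1 + (mTr M B : ℚ))) = (3 / 2) / (1 + (mTr M B : ℚ)) by ring,
      div_le_div_iff₀ (by positivity) (by positivity)]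
    nlinarith
  have hsum := Finset.sum_le_sum hterm
  rw [← Finset.mul_sum] at hsum
  rw [Finset.sum_sub_distrib]
  have e : ∑ B ∈ Rq M H 4, (7 / 6 : ℚ) * dem M H 4 B = (7 / 6 : ℚ) * ∑ B ∈ Rq M H 4, dem M H 4 B :=
    (Finset.mul_sum _ _ _).symm
  rw [e]
  linarith

end PercRepro.GenQ
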